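import Literature.AlgebraicGeometry.HodgeTheory.MaxRationalSubHodgeStructureKunnethTwoSurfaces
import Literature.AlgebraicGeometry.HodgeTheory.KunnethComponentsDiagonalAlgebraicLowDegrees
import HarnessLib

/-!
# Grothendieck's `max(X, 2q, q)` meets the coniveau-`(q − 1)` classes inside the algebraic classes; the odd
# Künneth pieces of a product of two surfaces; `HC(S₁ × S₂) ⟺` its `T(S₁) ⊗ T(S₂)` piece for ANY two
# smooth projective surfaces

Family `hodge`, layer `Literature/AlgebraicGeometry/HodgeTheory`; lane `lit-hodgefound` (Track 2 foundations,
Layer A1/A4). THEOREMS ONLY (no definition, no named fact; D-0026). Sequel of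
`MaxRationalSubHodgeStructureKunnethTwoSurfaces` (`HC(S₁ × S₂) ⟺` the two odd Künneth pieces and the
`T(S₁) ⊠ T(S₂)` piece) and of `KunnethComponentsDiagonalAlgebraicLowDegrees` /
`SupportedHodgeClassesAlgebraic` (Voisin 2013 Lemma 2.1 on the tree's carriers, with all its named-fact inputs
proved: `mem_algebraicClasses_of_mem_supportedClasses_of_isOfHodgeType`).

Sources, VERBATIM. C. Voisin, *The generalized Hodge and Bloch conjectures are equivalent for general complete
intersections*, Ann. Sci. ÉNS 46 (2013), p. 6: «Lemma 2.1. Conjecture 1.2 is satisfied by codimension `k`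
cycles whose cohomology class vanishes away from a codimension `k − 1` closed algebraic subset. […] there are
Hodge classes `αᵢ ∈ Hdg^{2k−2cᵢ}(Ỹᵢ, ℚ)`, such that `[Z] = Σᵢ j̃ᵢ*αᵢ` […] As `cᵢ ≥ k − 1` for all `i`'s, the
classes `αᵢ` are cycle classes on `Ỹᵢ` by the Lefschetz theorem on `(1,1)`-classes». C. Voisin, J. Open
Math. Probl. 1 (2025), §3.2.1 proof of Prop. 3.8: «The morphism `j_* ⊗ Id = (j, Id)_*` is a morphism of
polarized Hodge structures, hence we can apply Corollary 2.12 to conclude that `δ₁ = (j, Id)_*(β)` for some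
degree 2 Hodge class `β` […] The Hodge conjecture being known for degree 2 Hodge classes, we conclude that `β`
is algebraic». A. Grothendieck, Topology 8 (1969), p. 300 (the largest rational sub-Hodge structure of
`Fʳ Hᵏ`), p. 301 («for `i = 2p`, the Hodge conjecture (which need in this case not be corrected) is just the
usual Hodge conjecture»). C. Voisin, *Hodge Theory and Complex Algebraic Geometry I* (CUP 2002), §11.3.3 Thm.
11.38, Thm. 11.40, p. 286 («The Künneth components of such a class are still Hodge classes»), §11.3.1 Thm.
11.30. D. Huybrechts, *Lectures on K3 Surfaces* (CUP 2016), Ch. 3 §3.2–§3.3 (`T(X) = NS(X)^⊥`).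

## The mathematics

(1) For a smooth projective `X` and `q = p + 1`, `W := max(X, 2q, q) ∩ Nᵖ H^{2q}(X)` is admissible of level `q`
(intersection of admissible subspaces, `HodgeModel.inf_mem_ratSubHodgeInFilt`; `Nᵖ H^{2q}` is admissible of
level `p`, `HodgeModel.supportedClasses_mem_ratSubHodgeInFilt`), hence spanned by its rational classes, each of
which lies in `F^q H^{2q}` and is therefore of Hodge type `(q, q)`
(`IsRationalClass.isOfHodgeType_of_mem_hodgeFiltrationBetti`) — a Hodge class supported in codimension `≥ p`,
algebraic by Voisin's lemma. So **`max(X, 2q, q) ∩ N^{q−1} H^{2q}(X) ⊆ N^q H^{2q}(X)`: THE HODGE CONJECTURE HOLDS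
FOR THE HODGE CLASSES OF CONIVEAU `≥ q − 1`**, in every codimension `q` and for every `X`; in particular
`HC` in codimension `q` holds outright when `H^{2q}(X) = N^{q−1} H^{2q}(X)`.

(2) A Künneth piece `Hⁱ(X) ⊗ Hʲ(Y)` of `H^{2q}(X × Y)` has geometric coniveau `≥ (i − dim X)⁺ + (j − dim Y)⁺`
(`kunnethPiece_le_supportedClasses`); when this is `≥ q − 1` the component of `max(X × Y, 2q, q)` in that piece
is algebraic. For two surfaces and `q = 2` this settles the ODD pieces `H¹(S₁) ⊗ H³(S₂)`, `H³(S₁) ⊗ H¹(S₂)`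
(coniveau `1`), with no hypothesis on the irregularities — the classical «`H¹ ⊗ H³` classes are algebraic»
(Voisin's `(j, Id)_*(β)` argument) in the support-theoretic spelling.

(3) Hence, with the prequel, **`HC(S₁ × S₂) ⟺ max(S₁ × S₂, 4, 2) ∩ (T(S₁)_ℂ ⊠ T(S₂)_ℂ) ⊆ N²` FOR ANY TWO
SMOOTH PROJECTIVE SURFACES** (abelian, elliptic, general type …): the Hodge conjecture for a product of two
surfaces is exactly the algebraicity of the Hodge classes in the product of the transcendental lattices; and
`HC(S₁ × S₂)` holds OUTRIGHT as soon as one factor has `NS = H²` (`p_g = 0`: rational, ruled over any base,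
Enriques, bielliptic, Godeaux, …), whatever the other factor.

## What is proved

* §1 **`HodgeModel.maxRatSubHodgeInFilt_inf_supportedClasses_le_algebraicClasses`** (`max(2q, q) ∩ N^{q−1} ⊆ N^q`),
  `HodgeModel.le_algebraicClasses_of_mem_ratSubHodgeInFilt_of_le_supportedClasses` (admissible of level `q`
  inside `N^{q−1} H^{2q}` ⟹ algebraic), **`generalHodgePropertyFor_two_mul_of_supportedClasses_eq_top`**
  (`H^{2q} = N^{q−1} H^{2q} ⟹ GHC(X, 2q, q)`, i.e. `HC` in codimension `q`),
  `hodgeConjectureFor_of_forall_supportedClasses_eq_top`.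
* §2 `maxRatSubHodgeInFilt_inf_kunnethPiece_le_supportedClasses_of_le'` (free pieces, bidegree-indexed),
  **`maxRatSubHodgeInFilt_inf_kunnethPiece_le_supportedClasses_of_pred_le`** (pieces of coniveau `≥ q − 1` in
  bidegree `(2q, q)` are settled).
* §3 TWO SURFACES, NO HYPOTHESES: `maxRatSubHodgeInFilt_inf_kunnethPiece_one_three_le_supportedClasses`,
  `…_three_one_…` (the odd pieces), **`hodgeConjectureFor_surface_tensor_surface_iff`** (`HC(S₁ × S₂) ⟺` the
  `T(S₁) ⊠ T(S₂)` piece), `generalHodgePropertyFor_surface_tensor_surface_four_two_iff`,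
  **`hodgeConjectureFor_surface_tensor_surface_of_algebraicClasses_eq_top_left/_right`** (`NS = H²` on one side
  ⟹ `HC(S₁ × S₂)`), `hodgeConjectureFor_surface_tensor_surface_of_hodgePQ_two_zero_left/_right` (`p_g = 0` on
  one side ⟹ `HC(S₁ × S₂)`), and the curve × surface statement without regularity hypotheses
  **`forall_generalHodgePropertyFor_curve_tensor_surface_iff_transcendental'`** (`GHC(C × S, i, r)` for all
  `(i, r)` ⟺ `max(C × S, 3, 1) ∩ (H¹(C) ⊠ T(S)_ℂ) ⊆ N¹`, any curve `C`, any surface `S`).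

## References

* [Voisin2013GHCBloch] C. Voisin, The generalized Hodge and Bloch conjectures are equivalent for general complete
  intersections, Ann. Sci. ÉNS 46 (2013), Lemma 2.1 (proof).
* [Voisin2025] C. Voisin, Hodge and generalized Hodge conjectures, coniveau and algebraic cycles, J. Open Math.
  Probl. 1 (2025), §3.2.1 Prop. 3.8 (proof), Cor. 2.12, §4.1 Def. 4.1.
* [GrothendieckTopology1969] A. Grothendieck, Hodge's general conjecture is false for trivial reasons, Topology 8
  (1969) 299–303, pp. 300–301.
* [VoisinHodgeI2002] C. Voisin, Hodge Theory and Complex Algebraic Geometry I (CUP 2002), §11.3.3 Thm. 11.38,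
  Thm. 11.40, p. 286; §11.3.1 Thm. 11.30; §7.1.1.
* [Huybrechts2016K3] D. Huybrechts, Lectures on K3 Surfaces (CUP 2016), Ch. 3 §3.2–§3.3.
* [DeligneHodgeIII1974] P. Deligne, Théorie de Hodge III, Publ. Math. IHÉS 44 (1974), Cor. 8.2.8.
-/

noncomputable section

open CategoryTheory AlgebraicGeometry MonoidalCategory CartesianMonoidalCategory Finset
open Literature.AlgebraicTopology.SingularHomology
open Literature.Geometry.Kaehler
open Literature.AlgebraicGeometry.Motives (IsSmoothProjective ComplexPoints)

namespace Literature.AlgebraicGeometry.HodgeTheory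

variable {n m : ℕ} {X Y : Motives.SchemeOver ℂ}

/-! ### §1 `max(X, 2q, q) ∩ N^{q−1} H^{2q}(X) ⊆ N^q H^{2q}(X)` -/

/-- **THE HODGE CONJECTURE HOLDS FOR THE HODGE CLASSES OF CONIVEAU `≥ q − 1`** (Voisin 2013 Lemma 2.1 in
Grothendieck's language): for `X` smooth projective, `q = p + 1` and any Hodge model `A`,
`max(X, 2q, q) ∩ Nᵖ H^{2q}(X(ℂ); ℂ) ⊆ N^q H^{2q}(X(ℂ); ℂ) = algebraicClasses X q`. The intersection is admissible
of level `q`, hence spanned by rational classes of `F^q H^{2q}`, i.e. by Hodge classes, each supported in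
codimension `≥ p` and therefore algebraic (`mem_algebraicClasses_of_mem_supportedClasses_of_isOfHodgeType`:
Deligne's Gysin description of `Nᵖ`, the Gysin lift of Hodge classes, Hironaka, Lefschetz `(1,1)` — all proved
in the tree). [cite: Voisin2013GHCBloch, Lemma 2.1 (proof)] [cite: GrothendieckTopology1969, pp. 300–301]
[cite: Voisin2025, Cor. 2.12 and §3.2.1 Prop. 3.8 (proof)] [cite: DeligneHodgeIII1974, Cor. 8.2.8]
[cite: VoisinHodgeI2002, Thm. 11.30 and §7.1.1] -/
theorem HodgeModel.maxRatSubHodgeInFilt_inf_supportedClasses_le_algebraicClasses (A : HodgeModel n X)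
    (hX : IsSmoothProjective n X) {p q : ℕ} (hq : p + 1 = q) :
    A.maxRatSubHodgeInFilt (2 * q) q ⊓ supportedClasses X (2 * q) p ≤ algebraicClasses X q := by
  subst hq
  have hW : A.maxRatSubHodgeInFilt (2 * (p + 1)) (p + 1) ⊓ supportedClasses X (2 * (p + 1)) p ∈
      A.ratSubHodgeInFilt (2 * (p + 1)) (p + 1) :=
    A.inf_mem_ratSubHodgeInFilt hX (A.maxRatSubHodgeInFilt_mem _ _)
      (A.supportedClasses_mem_ratSubHodgeInFilt hX (2 * (p + 1)) p)
  refine ((isRationallySpanned_iff_le _).1 hW.1).trans (Submodule.span_le.2 ?_)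
  rintro c ⟨hcW, hcQ⟩
  exact mem_algebraicClasses_of_mem_supportedClasses_of_isOfHodgeType
    Deligne1974_ker_restrictCompl_eq_iSup_range_complexGysin_holds
    Voisin2025_hodgeClass_lift_complexGysin_holds (gysinMap_restrictCompl_eq_zero_of_field ℂ)
    Resolution.Hironaka1964_projective_holds lefschetzOneOne_rational_holds complexOrientationFamily
    hasPoincareDuality_complexOrientationFamily hX p (Submodule.mem_inf.1 hcW).2 hcQ
    (hcQ.isOfHodgeType_of_mem_hodgeFiltrationBetti hX A (by omega) (hW.2.2 hcW))

/-- **An admissible subspace of `(H^{2q}, F^q)` lying in `N^{q−1} H^{2q}` consists of algebraic classes.**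
[cite: Voisin2013GHCBloch, Lemma 2.1 (proof)] [cite: GrothendieckTopology1969, pp. 300–301] -/
theorem HodgeModel.le_algebraicClasses_of_mem_ratSubHodgeInFilt_of_le_supportedClasses (A : HodgeModel n X)
    (hX : IsSmoothProjective n X) {p q : ℕ} (hq : p + 1 = q) {W : Submodule ℂ (complexBetti X (2 * q))}
    (hW : W ∈ A.ratSubHodgeInFilt (2 * q) q) (hWN : W ≤ supportedClasses X (2 * q) p) :
    W ≤ algebraicClasses X q :=
  (le_inf (A.le_maxRatSubHodgeInFilt hW) hWN).trans (A.maxRatSubHodgeInFilt_inf_supportedClasses_le_algebraicClasses hX hq)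

/-- **`HC` IN CODIMENSION `q` WHEN `H^{2q}(X) = N^{q−1} H^{2q}(X)`**: if every class of degree `2q` is supported
in codimension `q − 1` (e.g. `H^{2q}(X)` is carried by a divisor), then `GHC(X, 2q, q)` — every rational
`(q, q)`-class is algebraic. [cite: Voisin2013GHCBloch, Lemma 2.1 (proof)] [cite: GrothendieckTopology1969, p. 301] -/
theorem generalHodgePropertyFor_two_mul_of_supportedClasses_eq_top (hX : IsSmoothProjective n X) {p q : ℕ}
    (hq : p + 1 = q) (h : supportedClasses X (2 * q) p = ⊤) : GeneralHodgePropertyFor n X (2 * q) q := by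
  obtain ⟨A⟩ := nonempty_hodgeModel_holds hX
  refine (generalHodgePropertyFor_iff_of_hodgeModel A hX (2 * q) q).2 ?_
  calc A.maxRatSubHodgeInFilt (2 * q) q
      = A.maxRatSubHodgeInFilt (2 * q) q ⊓ supportedClasses X (2 * q) p := by rw [h, inf_top_eq]
    _ ≤ algebraicClasses X q := A.maxRatSubHodgeInFilt_inf_supportedClasses_le_algebraicClasses hX hq

/-- **`HC(X)` when every even cohomology group has coniveau one less than the codimension**:
`H^{2q}(X) = N^{q−1} H^{2q}(X)` for all `q ≥ 1` implies the Hodge conjecture for `X` (codimension `0` is free).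
[cite: Voisin2013GHCBloch, Lemma 2.1 (proof)] [cite: GrothendieckTopology1969, p. 301] -/
theorem hodgeConjectureFor_of_forall_supportedClasses_eq_top (hX : IsSmoothProjective n X)
    (h : ∀ p : ℕ, supportedClasses X (2 * (p + 1)) p = ⊤) : HodgeConjectureFor n X := by
  refine hodgeConjectureFor_of_generalHodgePropertyFor fun q ↦ ?_
  cases q with
  | zero => exact generalHodgePropertyFor_two_mul_self_of_lefschetzRange hX (Or.inl (Nat.zero_le 1))
  | succ p => exact generalHodgePropertyFor_two_mul_of_supportedClasses_eq_top hX rfl (h p)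

/-! ### §2 Künneth pieces of coniveau `≥ q − 1` in bidegree `(2q, q)` -/

/-- **Free pieces, bidegree-indexed**: `max(X × Y, k, r) ∩ (Hⁱ(X) ⊗ Hʲ(Y)) ⊆ Nʳ` whenever
`r ≤ (i − dim X)⁺ + (j − dim Y)⁺` (the whole piece has that geometric coniveau, `kunnethPiece_le_supportedClasses`;
the tree's `HodgeModel.maxRatSubHodgeInFilt_inf_kunnethPiece_le_supportedClasses_of_le` is the `Fin`-indexed
spelling). [cite: Voisin2025, §4.1 Def. 4.1 and §4.3 (first paragraph)] [cite: GrothendieckTopology1969, §1] -/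
theorem maxRatSubHodgeInFilt_inf_kunnethPiece_le_supportedClasses_of_le' (hX : IsSmoothProjective n X)
    (hY : IsSmoothProjective m Y) (C : HodgeModel (n + m) (X ⊗ Y)) {i j k r : ℕ} (hk : i + j = k)
    (hr : r ≤ (i - n) + (j - m)) :
    C.maxRatSubHodgeInFilt k r ⊓ kunnethPiece X Y hk ≤ supportedClasses (X ⊗ Y) k r :=
  inf_le_right.trans ((kunnethPiece_le_supportedClasses hX hY hk).trans (supportedClasses_mono _ k hr))

/-- **The Künneth components of `max(X × Y, 2q, q)` over pieces of geometric coniveau `≥ q − 1` are algebraic**: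
for `i + j = 2q`, `q = p + 1` and `p ≤ (i − dim X)⁺ + (j − dim Y)⁺`,
`max(X × Y, 2q, q) ∩ (Hⁱ(X) ⊗ Hʲ(Y)) ⊆ N^q H^{2q}(X × Y)` («The Künneth components of such a class are still
Hodge classes», and Hodge classes of coniveau `≥ q − 1` are algebraic, §1).
[cite: VoisinHodgeI2002, §11.3.3 p. 286 and Thm. 11.40] [cite: Voisin2013GHCBloch, Lemma 2.1 (proof)]
[cite: Voisin2025, §3.2.1 Prop. 3.8 (proof)] -/
theorem maxRatSubHodgeInFilt_inf_kunnethPiece_le_supportedClasses_of_pred_le (hX : IsSmoothProjective n X)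
    (hY : IsSmoothProjective m Y) (C : HodgeModel (n + m) (X ⊗ Y)) {i j p q : ℕ} (hk : i + j = 2 * q)
    (hq : p + 1 = q) (hp : p ≤ (i - n) + (j - m)) :
    C.maxRatSubHodgeInFilt (2 * q) q ⊓ kunnethPiece X Y hk ≤ supportedClasses (X ⊗ Y) (2 * q) q :=
  (inf_le_inf_left _ ((kunnethPiece_le_supportedClasses hX hY hk).trans (supportedClasses_mono _ _ hp))).trans
    (C.maxRatSubHodgeInFilt_inf_supportedClasses_le_algebraicClasses (hX.tensor_holds hY) hq)

/-! ### §3 Two surfaces, no hypotheses: the odd pieces; `HC(S₁ × S₂) ⟺` the `T(S₁) ⊗ T(S₂)` piece -/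

variable {S₁ S₂ : Motives.SchemeOver ℂ}

/-- **The odd piece `H¹(S₁) ⊗ H³(S₂)` never obstructs `HC(S₁ × S₂)`**: its part of `max(S₁ × S₂, 4, 2)` lies in
`N²` (the piece has coniveau `1` — `H³(S₂)` is carried by curves — and its Hodge classes are algebraic by §1),
for ANY two smooth projective surfaces. [cite: Voisin2025, §3.2.1 Prop. 3.8 (proof)]
[cite: Voisin2013GHCBloch, Lemma 2.1 (proof)] [cite: VoisinHodgeI2002, §6.2.3 Thm. 6.25 and §11.3.3 p. 286] -/
theorem maxRatSubHodgeInFilt_inf_kunnethPiece_one_three_le_supportedClasses (hS₁ : IsSmoothProjective 2 S₁)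
    (hS₂ : IsSmoothProjective 2 S₂) (C : HodgeModel (2 + 2) (S₁ ⊗ S₂)) (hk : 1 + 3 = 2 * 2) :
    C.maxRatSubHodgeInFilt (2 * 2) 2 ⊓ kunnethPiece S₁ S₂ hk ≤ supportedClasses (S₁ ⊗ S₂) (2 * 2) 2 :=
  maxRatSubHodgeInFilt_inf_kunnethPiece_le_supportedClasses_of_pred_le hS₁ hS₂ C hk (show 1 + 1 = 2 by rfl)
    (by decide)

/-- **The odd piece `H³(S₁) ⊗ H¹(S₂)` never obstructs `HC(S₁ × S₂)`** (mirror statement).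
[cite: Voisin2025, §3.2.1 Prop. 3.8 (proof)] [cite: Voisin2013GHCBloch, Lemma 2.1 (proof)]
[cite: VoisinHodgeI2002, §6.2.3 Thm. 6.25 and §11.3.3 p. 286] -/
theorem maxRatSubHodgeInFilt_inf_kunnethPiece_three_one_le_supportedClasses (hS₁ : IsSmoothProjective 2 S₁)
    (hS₂ : IsSmoothProjective 2 S₂) (C : HodgeModel (2 + 2) (S₁ ⊗ S₂)) (hk : 3 + 1 = 2 * 2) :
    C.maxRatSubHodgeInFilt (2 * 2) 2 ⊓ kunnethPiece S₁ S₂ hk ≤ supportedClasses (S₁ ⊗ S₂) (2 * 2) 2 :=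
  maxRatSubHodgeInFilt_inf_kunnethPiece_le_supportedClasses_of_pred_le hS₁ hS₂ C hk (show 1 + 1 = 2 by rfl)
    (by decide)

/-- **THE HODGE CONJECTURE FOR A PRODUCT OF TWO SMOOTH PROJECTIVE SURFACES IS EXACTLY THE ALGEBRAICITY OF
ITS `T(S₁) ⊗ T(S₂)` PIECE — NO HYPOTHESIS ON `S₁`, `S₂`**: `HC(S₁ × S₂)` holds iff the part of
`max(S₁ × S₂, 4, 2)` (the `ℂ`-span of the Hodge classes of `H⁴(S₁ × S₂)`) inside `T(S₁)_ℂ ⊠ T(S₂)_ℂ`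
(`T = NS^⊥` for the intersection form) consists of classes of algebraic `2`-cycles. All the other constituents
— bidegrees `(2p, p)` with `p ≠ 2` (Lefschetz range), the pieces `H⁰ ⊗ H⁴`, `H⁴ ⊗ H⁰` (algebraic cohomology),
`H¹ ⊗ H³`, `H³ ⊗ H¹` (§3, coniveau `1`) and `NS(S₁) ⊠ NS(S₂)` (products of divisors) — are algebraic
unconditionally. [cite: GrothendieckTopology1969, pp. 300–301] [cite: VoisinHodgeI2002, §11.3.1 Thm. 11.30, §11.3.3 Thm. 11.38 and p. 286]
[cite: Voisin2013GHCBloch, Lemma 2.1 (proof)] [cite: Huybrechts2016K3, Ch. 3 §3.2–§3.3]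
[cite: Hartshorne1977, V Thm. 1.9 and V Rem. 1.9.1] -/
theorem hodgeConjectureFor_surface_tensor_surface_iff (hS₁ : IsSmoothProjective 2 S₁)
    (hS₂ : IsSmoothProjective 2 S₂) (C : HodgeModel (2 + 2) (S₁ ⊗ S₂)) :
    HodgeConjectureFor (2 + 2) (S₁ ⊗ S₂) ↔
      C.maxRatSubHodgeInFilt (2 * 2) 2 ⊓ Submodule.map₂
          ((cupProduct (show 2 * 1 + 2 * 1 = 2 * 2 by omega)).compl₁₂
            (complexBetti.map (fst S₁ S₂) (2 * 1)).hom (complexBetti.map (snd S₁ S₂) (2 * 1)).hom)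
          (LinearMap.BilinForm.orthogonal
            (cupPairing (complexOrientationFamily hS₁) (show 2 * 1 + 2 * 1 = 2 * 2 by omega)) (algebraicClasses S₁ 1))
          (LinearMap.BilinForm.orthogonal
            (cupPairing (complexOrientationFamily hS₂) (show 2 * 1 + 2 * 1 = 2 * 2 by omega)) (algebraicClasses S₂ 1)) ≤
        supportedClasses (S₁ ⊗ S₂) (2 * 2) 2 := by
  rw [hodgeConjectureFor_surface_tensor_surface_iff_odd_and_transcendental hS₁ hS₂ C]
  exact ⟨fun h ↦ h.2.2, fun h ↦ ⟨maxRatSubHodgeInFilt_inf_kunnethPiece_one_three_le_supportedClasses hS₁ hS₂ C _,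
    maxRatSubHodgeInFilt_inf_kunnethPiece_three_one_le_supportedClasses hS₁ hS₂ C _, h⟩⟩

/-- **`GHC(S₁ × S₂, 4, 2)` — the Hodge conjecture for `2`-cycles on the fourfold `S₁ × S₂` — ⟺ the `T(S₁) ⊠ T(S₂)`
piece**, for any two smooth projective surfaces (the other bidegrees of `HC(S₁ × S₂)` being in the Lefschetz
range). [cite: GrothendieckTopology1969, pp. 300–301] [cite: VoisinHodgeI2002, §11.3.1 Thm. 11.30 and §11.3.3] -/
theorem generalHodgePropertyFor_surface_tensor_surface_four_two_iff (hS₁ : IsSmoothProjective 2 S₁)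
    (hS₂ : IsSmoothProjective 2 S₂) (C : HodgeModel (2 + 2) (S₁ ⊗ S₂)) :
    GeneralHodgePropertyFor (2 + 2) (S₁ ⊗ S₂) (2 * 2) 2 ↔
      C.maxRatSubHodgeInFilt (2 * 2) 2 ⊓ Submodule.map₂
          ((cupProduct (show 2 * 1 + 2 * 1 = 2 * 2 by omega)).compl₁₂
            (complexBetti.map (fst S₁ S₂) (2 * 1)).hom (complexBetti.map (snd S₁ S₂) (2 * 1)).hom)
          (LinearMap.BilinForm.orthogonal
            (cupPairing (complexOrientationFamily hS₁) (show 2 * 1 + 2 * 1 = 2 * 2 by omega)) (algebraicClasses S₁ 1))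
          (LinearMap.BilinForm.orthogonal
            (cupPairing (complexOrientationFamily hS₂) (show 2 * 1 + 2 * 1 = 2 * 2 by omega)) (algebraicClasses S₂ 1)) ≤
        supportedClasses (S₁ ⊗ S₂) (2 * 2) 2 := by
  have hS := hS₁.tensor_holds hS₂
  rw [← hodgeConjectureFor_surface_tensor_surface_iff hS₁ hS₂ C, hodgeConjectureFor_iff_forall_generalHodgePropertyFor hS]
  refine ⟨fun h p ↦ ?_, fun h ↦ h 2⟩
  by_cases hp : p ≤ 1 ∨ 2 + 2 ≤ p + 1
  · exact generalHodgePropertyFor_two_mul_self_of_lefschetzRange hS hp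
  · obtain rfl : p = 2 := by omega
    exact h

/-- **`HC(S₁ × S₂)` OUTRIGHT WHEN `NS(S₁)_ℂ = H²(S₁)`** (all of `H²(S₁)` algebraic, e.g. `p_g(S₁) = 0`: rational
and ruled surfaces over any base, Enriques, bielliptic, Godeaux surfaces, …), for EVERY smooth projective surface
`S₂`: then `T(S₁)_ℂ = 0`. [cite: GrothendieckTopology1969, pp. 300–301] [cite: Hartshorne1977, V Thm. 1.9 and V Rem. 1.9.1]
[cite: VoisinHodgeI2002, §11.3.1 Thm. 11.30 and §11.3.3] -/
theorem hodgeConjectureFor_surface_tensor_surface_of_algebraicClasses_eq_top_left (hS₁ : IsSmoothProjective 2 S₁)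
    (hS₂ : IsSmoothProjective 2 S₂) (h : algebraicClasses S₁ 1 = ⊤) : HodgeConjectureFor (2 + 2) (S₁ ⊗ S₂) := by
  obtain ⟨C⟩ := nonempty_hodgeModel_holds (hS₁.tensor_holds hS₂)
  have hT : LinearMap.BilinForm.orthogonal
      (cupPairing (complexOrientationFamily hS₁) (show 2 * 1 + 2 * 1 = 2 * 2 by omega)) (algebraicClasses S₁ 1) = ⊥ := by
    have hc := (isCompl_algebraicClasses_orthogonal hS₁).inf_eq_bot
    rw [h] at hc ⊢
    rwa [top_inf_eq] at hc
  rw [hodgeConjectureFor_surface_tensor_surface_iff hS₁ hS₂ C, hT, Submodule.map₂_bot_left, inf_bot_eq]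
  exact bot_le

/-- **`HC(S₁ × S₂)` OUTRIGHT WHEN `NS(S₂)_ℂ = H²(S₂)`**, for EVERY smooth projective surface `S₁`.
[cite: GrothendieckTopology1969, pp. 300–301] [cite: Hartshorne1977, V Thm. 1.9 and V Rem. 1.9.1]
[cite: VoisinHodgeI2002, §11.3.1 Thm. 11.30 and §11.3.3] -/
theorem hodgeConjectureFor_surface_tensor_surface_of_algebraicClasses_eq_top_right (hS₁ : IsSmoothProjective 2 S₁)
    (hS₂ : IsSmoothProjective 2 S₂) (h : algebraicClasses S₂ 1 = ⊤) : HodgeConjectureFor (2 + 2) (S₁ ⊗ S₂) := by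
  obtain ⟨C⟩ := nonempty_hodgeModel_holds (hS₁.tensor_holds hS₂)
  have hT : LinearMap.BilinForm.orthogonal
      (cupPairing (complexOrientationFamily hS₂) (show 2 * 1 + 2 * 1 = 2 * 2 by omega)) (algebraicClasses S₂ 1) = ⊥ := by
    have hc := (isCompl_algebraicClasses_orthogonal hS₂).inf_eq_bot
    rw [h] at hc ⊢
    rwa [top_inf_eq] at hc
  rw [hodgeConjectureFor_surface_tensor_surface_iff hS₁ hS₂ C, hT, Submodule.map₂_bot_right, inf_bot_eq]
  exact bot_le

/-- **`p_g(S₁) = 0 ⟹ HC(S₁ × S₂)` for every smooth projective surface `S₂`** (`h^{2,0}(S₁) = 0` makes `H²(S₁)`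
of type `(1,1)`, hence algebraic by Lefschetz `(1,1)`: the tree's `algebraicClasses_one_eq_top_of_hodgePQ_two_zero`).
[cite: VoisinHodgeI2002, §11.3.1 Thm. 11.30 and §6.1.3] [cite: GrothendieckTopology1969, pp. 300–301] -/
theorem hodgeConjectureFor_surface_tensor_surface_of_hodgePQ_two_zero_left (hS₁ : IsSmoothProjective 2 S₁)
    (hS₂ : IsSmoothProjective 2 S₂) (h20 : ∃ A : HodgeModel 2 S₁, Module.finrank ℂ ↥(A.hodgePQ 2 2 0) = 0) :
    HodgeConjectureFor (2 + 2) (S₁ ⊗ S₂) :=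
  hodgeConjectureFor_surface_tensor_surface_of_algebraicClasses_eq_top_left hS₁ hS₂
    (algebraicClasses_one_eq_top_of_hodgePQ_two_zero hS₁ h20)

/-- **`p_g(S₂) = 0 ⟹ HC(S₁ × S₂)` for every smooth projective surface `S₁`.**
[cite: VoisinHodgeI2002, §11.3.1 Thm. 11.30 and §6.1.3] [cite: GrothendieckTopology1969, pp. 300–301] -/
theorem hodgeConjectureFor_surface_tensor_surface_of_hodgePQ_two_zero_right (hS₁ : IsSmoothProjective 2 S₁)
    (hS₂ : IsSmoothProjective 2 S₂) (h20 : ∃ B : HodgeModel 2 S₂, Module.finrank ℂ ↥(B.hodgePQ 2 2 0) = 0) :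
    HodgeConjectureFor (2 + 2) (S₁ ⊗ S₂) :=
  hodgeConjectureFor_surface_tensor_surface_of_algebraicClasses_eq_top_right hS₁ hS₂
    (algebraicClasses_one_eq_top_of_hodgePQ_two_zero hS₂ h20)

/-- **GROTHENDIECK'S `GHC` FOR `C × S` IN EVERY BIDEGREE ⟺ ITS TRANSCENDENTAL PIECE `H¹(C) ⊗ T(S)_ℂ`, for ANY
smooth projective curve `C` and ANY smooth projective surface `S`** (the prequel
`forall_generalHodgePropertyFor_curve_tensor_surface_iff_transcendental` without its `H¹(S) = H³(S) = 0`
hypothesis): the window of the threefold `C × S` is `(3, 1)`; the pieces `H⁰(C) ⊗ H³(S)` and `H²(C) ⊗ H¹(S)` of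
`H³(C × S)` have coniveau `1` for free, and the Néron–Severi part of `H¹(C) ⊗ H²(S)` is settled by the trivial
`GHC(C, 1, 0)`. [cite: GrothendieckTopology1969, pp. 300–301] [cite: Huybrechts2016K3, Ch. 3 §3.2–§3.3]
[cite: Voisin2025, §4.1 Def. 4.1] [cite: VoisinHodgeI2002, §6.2.3 Thm. 6.25 and §11.3.3 Thm. 11.38] -/
theorem forall_generalHodgePropertyFor_curve_tensor_surface_iff_transcendental' {C₀ S : Motives.SchemeOver ℂ}
    (hC : IsSmoothProjective 1 C₀) (hS : IsSmoothProjective 2 S) (C : HodgeModel (1 + 2) (C₀ ⊗ S)) :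
    (∀ i r : ℕ, GeneralHodgePropertyFor 3 (C₀ ⊗ S) i r) ↔
      C.maxRatSubHodgeInFilt 3 1 ⊓ Submodule.map₂
        ((cupProduct (show 1 + 2 * 1 = 3 by omega)).compl₁₂ (complexBetti.map (fst C₀ S) 1).hom
          (complexBetti.map (snd C₀ S) (2 * 1)).hom) ⊤
        (LinearMap.BilinForm.orthogonal
          (cupPairing (complexOrientationFamily hS) (show 2 * 1 + 2 * 1 = 2 * 2 by omega)) (algebraicClasses S 1)) ≤
      supportedClasses (C₀ ⊗ S) 3 1 := by
  classical
  have hCS : IsSmoothProjective 3 (C₀ ⊗ S) := hC.tensor_holds hS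
  refine ⟨fun h ↦ inf_le_left.trans ((generalHodgePropertyFor_iff_of_hodgeModel C hCS 3 1).1 (h 3 1)), fun hT i r ↦ ?_⟩
  by_cases hw : i ≠ 3 ∨ r ≠ 1
  · exact generalHodgePropertyFor_of_dim_three hCS hw
  · obtain ⟨rfl, rfl⟩ : i = 3 ∧ r = 1 := by
      constructor <;> by_contra h' <;> simp_all
    rw [generalHodgePropertyFor_tensor_iff_forall_inf_kunnethPiece_le' hC hS C 3 1]
    intro i j hk
    rcases (show j = 0 ∨ j = 1 ∨ j = 2 ∨ j = 3 ∨ 2 * 2 < j by omega) with rfl | rfl | rfl | rfl | hj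
    · obtain rfl : i = 3 := by omega
      haveI := subsingleton_complexBetti hC (show 2 * 1 < 3 by omega)
      rw [kunnethPiece_eq_bot_of_subsingleton_left hk, inf_bot_eq]
      exact bot_le
    · obtain rfl : i = 2 := by omega
      exact maxRatSubHodgeInFilt_inf_kunnethPiece_le_supportedClasses_of_le' hC hS C hk (by decide)
    · obtain rfl : i = 1 := by omega
      exact maxRatSubHodgeInFilt_inf_kunnethPiece_le_supportedClasses_of_transcendental hC hS C hk
        (fun _ ↦ generalHodgePropertyFor_of_dim_le_two (by omega) hC 1 (1 - 1)) hT
    · obtain rfl : i = 0 := by omega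
      exact maxRatSubHodgeInFilt_inf_kunnethPiece_le_supportedClasses_of_le' hC hS C hk (by decide)
    · haveI := subsingleton_complexBetti hS hj
      rw [kunnethPiece_eq_bot_of_subsingleton hk, inf_bot_eq]
      exact bot_le

end Literature.AlgebraicGeometry.HodgeTheory

end
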